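/-
Copyright (c) 2026. All rights reserved.
Released under Apache 2.0 license as described in the file LICENSE.
Authors: abc-iut cell, prover seat abc-iut-L4-t12 (gen 8).
-/
import Literature.AnabelianGeometry.AbsoluteAnabelian.IdRigidMapsToFullSubcategory
import Literature.AnabelianGeometry.AbsoluteAnabelian.ArchimedeanHolFieldFunctorGeometricPuncturedTorusOuter
import HarnessLib

/-!
# `EA^hol_RS(Q)` at the once-punctured elliptic curve, every cover-closed `Q`

PROOF-ONLY corollary file (abc-iut cell, campaign-L item R1.2 of the `EA` column of [AbsTopIII]
Prop 4.2 / Cor 4.5).  abc-iut-w5-d144's `HolRS.isIdRigid_mapsTo_puncturedTorus` (the full subcategory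
of `HolRS` of objects mapping to `E ∖ {x₀}` is id-rigid, unconditionally — print's Prop 4.2 (i) at the
type-`(1,1)` object through Lemma 4.3's route, S. Mochizuki, *Topics in Absolute Anabelian Geometry
III*, p.106) transported into `EA^hol_RS(Q) = Q.FullSubcategory` for every object property `Q` of
`HolRS` closed under finite étale covers (`isIdRigid_mapsTo_fullSubcategory_iff`):

* `HolRS.isIdRigid_mapsTo_fullSubcategory_puncturedTorus` — for every cover-closed `Q ∋ E ∖ {x₀}`:
  «objects of `EA^hol_RS(Q)` mapping to `E ∖ {x₀}`» is id-rigid — gen 7's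
  `isIdRigid_mapsTo_puncturedTorus_of` (whose hypothesis (H1) is unsatisfiable there, `[-1] ∈ Aut`)
  superseded by an unconditional statement of the same shape.

HONEST SCOPE: model level; nothing here bears on [IUTchIII] Cor. 3.12; model ≠ reconstruction;
support library, not a node.  No definitions.
-/

noncomputable section

open CategoryTheory
open Literature.Geometry.Kaehler

namespace Literature.AnabelianGeometry.AbsoluteAnabelian

namespace HolRS

variable (Φ : (Fin 2 → ℝ) ≃L[ℝ] ℂ) (x₀ : ComplexTorus Φ)

/-- **«Objects of `EA^hol_RS(Q)` mapping to the once-punctured elliptic curve `E ∖ {x₀}`» is id-rigid —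
UNCONDITIONALLY**, for every `Q ⊆ HolRS` closed under finite étale covers with `E ∖ {x₀} ∈ Q`.
[cite: MochizukiAbsTopIII2015, Proposition 4.2 (i) p.106] -/
theorem isIdRigid_mapsTo_fullSubcategory_puncturedTorus (Q : ObjectProperty HolRS) (hQ : IsCoverClosed Q)
    (hXQ : Q (puncturedTorus Φ x₀)) :
    IsIdRigid (ObjectProperty.FullSubcategory fun Y : Q.FullSubcategory =>
      Nonempty (Y ⟶ ⟨puncturedTorus Φ x₀, hXQ⟩)) :=
  (isIdRigid_mapsTo_fullSubcategory_iff Q hQ ⟨puncturedTorus Φ x₀, hXQ⟩).2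
    (isIdRigid_mapsTo_puncturedTorus Φ x₀)

/-- In particular for `Q = ⊤`. [cite: MochizukiAbsTopIII2015, Proposition 4.2 (i) p.106] -/
theorem isIdRigid_mapsTo_puncturedTorus_top :
    IsIdRigid (ObjectProperty.FullSubcategory fun Y : (⊤ : ObjectProperty HolRS).FullSubcategory =>
      Nonempty (Y ⟶ ⟨puncturedTorus Φ x₀, trivial⟩)) :=
  isIdRigid_mapsTo_fullSubcategory_puncturedTorus Φ x₀ ⊤ isCoverClosed_top trivial

end HolRS

end Literature.AnabelianGeometry.AbsoluteAnabelian
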